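import Mathlib
import Summits.NavierStokesRegularity.FluidComputer.AbcClassIIEigenpairClassical
import Summits.NavierStokesRegularity.FluidComputer.AbcClassIIEigenpairRow1002C
import Summits.NavierStokesRegularity.FluidComputer.CertificateAbcSpectrumThirdChain
import Summits.NavierStokesRegularity.FluidComputer.AbcLyapunovInstability

/-!
# T0 ROW `Row1002C` (R = 100, class II, implementation 3) AS A **CLASSICAL CLASS-II EIGENPAIR** — instab3 g8's glue item for the
# INERTIA-3L census sentence «σ(L_100|II) ∩ {Re ≥ a} = {λ⋆} EXACTLY» (profile-cert-3 g9, 2026-08-27)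
HONEST FRAMING (D-0035/D-0074): not a claim about Navier–Stokes blow-up. WHAT THIS IS NOT: not NS evidence;
MODEL lane (NS linearised about `abcFlow 1 1 1` at viscosity `1/(2π·100)`, class II); no certificate, number or census
word moves; CONDITIONAL on the row's transcribed facts (as `AbcClassIIEigenpairRow1002CComplex`), in the certifier's own
COMPLEX orbit basis (AUDIT-BASIS-ℂ j268037 PASSED for implementation 3).
**`row1002C_classII_eigenpair_of_complex_bases`**: the row's facts ⇒ there are `λ⋆` and `u` with `|λ⋆ − λ̃| ≤ Row1002C.rho`,
`Im λ⋆ = 0`, `Row1002C.lamRe − Row1002C.rho ≤ Re λ⋆` (so `Re λ⋆ > 0`), `Torus.LinNSResolventRel (1/(2π·100)) (abcFlow 1 1 1) (2πλ⋆) u 0`,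
`u ≠ 0`, **`IsClassII (mFourierCoeff u)`**, EVERY classical class-II eigenpair `(z, u')` with `|z − λ⋆| < Row1002C.rIso` has
`z = λ⋆`, and (+ FPS06) rung R-α — i.e. exactly the data `(lam, ulam, hlam, hlam0, hlamII, hlamre)` of
`AbcInertiaRows.eq_leader_of_card_le_one` (with any `a ≤ Row1002C.lamRe − Row1002C.rho`). The closings are those of
`AbcClassIIEigenpairRow1002CUnique` repeated; the analytic step is `classII_eigenpair_of_nested_certificate`
(`AbcClassIIEigenpairClassical`). Mathlib + the files named; no new definitions. bears_on LADDER-NS N5 / Z4-a(1) (T0) →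
N1* T6 (INERTIA-3L glue), N1* R-α.
-/

noncomputable section

open scoped BigOperators ComplexConjugate InnerProductSpace
open Finset MeasureTheory UnitAddTorus

namespace Summit.NavierStokesRegularity.FluidComputer.AbcClassIIEigenpair

open Literature.Analysis.FunctionSpaces Literature.Analysis.FunctionSpaces.Torus
open Literature.Analysis.FluidPDE
open Summit.NavierStokesRegularity.FluidComputer.AbcClassII
open Summit.NavierStokesRegularity.FluidComputer.CertificateAbcSpectrum

section Row

variable (wf : Idx → Fam)
variable (hws : ∀ i : Idx, ∀ k ∉ i.1.1, wf i k = 0)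
variable (hwt : ∀ (i : Idx) (k : Fin 3 → ℤ), ∑ j : Fin 3, ((k j : ℤ) : ℂ) * wf i k j = 0)
variable (hwII : ∀ i : Idx, IsClassII (wf i))
variable (hwon : ∀ (O : Orbit) (a b : Fin (odim O)),
  ∑ k ∈ O.1, (inner ℂ (wf ⟨O, a⟩ k) (wf ⟨O, b⟩ k) : ℂ) = if a = b then 1 else 0)
variable (amc : Idx → Idx → ℂ)
variable (hamc : ∀ i j : Idx, amc i j =
  ∑ k ∈ i.1.1, (inner ℂ (wf i k) (Torus.lerayCoeff k (crossForm 1 1 1 (wf j) k)) : ℂ))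

include hws hwt hwII hwon hamc in
/-- **T0 (R = 100, class II, implementation 3) as a CLASSICAL CLASS-II EIGENPAIR `(λ⋆, u)` with `u ≠ 0`, `IsClassII (𝓕 u)`,
`Row1002C.lamRe − Row1002C.rho ≤ Re λ⋆`, the (D7) exclusivity within `Row1002C.rIso`, and rung R-α** — CONDITIONAL on the row's transcribed facts. -/
theorem row1002C_classII_eigenpair_of_complex_bases
    (vt : Idx → ℂ) (hvt0 : ∀ i, i ∉ cubeIdx 60 → vt i = 0)
    (hres : ∑ i ∈ cubeIdx 60 ∪ (cubeIdx 60).biUnion nbrIdx,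
      ‖(if i ∈ cubeIdx 60 then ((((Row1002C.lamRe : ℚ) : ℝ) : ℂ) - ((-(onormSq i.1 / 100) : ℝ) : ℂ)) * vt i
          else 0) - ∑ j ∈ cubeIdx 60, amc i j * vt j‖ ^ 2 ≤ ((Row1002C.rnorm : ℚ) : ℝ) ^ 2)
    (hntb : ∑ i ∈ cubeIdx 60 \ cubeIdx 17, ‖vt i‖ ^ 2 ≤
      (((5424754208064971 : ℚ) / 2305843009213693952 : ℚ) : ℝ) ^ 2)
    (Binv : ((↥(cubeIdx 17) → ℂ) × ℂ) →ₗ[ℂ] ((↥(cubeIdx 17) → ℂ) × ℂ))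
    (hBinv : ∀ (c : ↥(cubeIdx 17) → ℂ) (m : ℂ),
      Binv (fun i : ↥(cubeIdx 17) =>
          ((((Row1002C.lamRe : ℚ) : ℝ) : ℂ) - ((-(onormSq i.1.1 / 100) : ℝ) : ℂ)) * c i -
          ∑ j : ↥(cubeIdx 17), amc i j * c j + m * vt i,
        ∑ i : ↥(cubeIdx 17), conj (vt i) * c i) = (c, m))
    (hαM : ∀ (c : ↥(cubeIdx 17) → ℂ) (g : ℂ),
      ∑ j : ↥(cubeIdx 17), ‖(Binv (c, g)).1 j‖ ^ 2 + ‖(Binv (c, g)).2‖ ^ 2 ≤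
        ((Row1002C.alpha0 : ℚ) : ℝ) ^ 2 * (∑ i : ↥(cubeIdx 17), ‖c i‖ ^ 2 + ‖g‖ ^ 2))
    (hβBM : ∀ w : Idx → ℂ,
      ∑ j : ↥(cubeIdx 17), ‖(Binv (fun i : ↥(cubeIdx 17) => -∑ j ∈ nbrIdx i \ cubeIdx 17,
          amc i j * w j, 0)).1 j‖ ^ 2 +
        ‖(Binv (fun i : ↥(cubeIdx 17) => -∑ j ∈ nbrIdx i \ cubeIdx 17,
          amc i j * w j, 0)).2‖ ^ 2 ≤
        ((Row1002C.betaB : ℚ) : ℝ) ^ 2 * ∑ j ∈ (cubeIdx 17).biUnion nbrIdx \ cubeIdx 17, ‖w j‖ ^ 2)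
    (hβCM : ∀ (c : ↥(cubeIdx 17) → ℂ) (g : ℂ),
      ∑ i ∈ ((cubeIdx 17).biUnion nbrIdx ∪ cubeIdx 60) \ cubeIdx 17,
        ‖-∑ j : ↥(cubeIdx 17), amc i j * (Binv (c, g)).1 j +
          (Binv (c, g)).2 * vt i‖ ^ 2 ≤
        ((Row1002C.betaC : ℚ) : ℝ) ^ 2 * (∑ i : ↥(cubeIdx 17), ‖c i‖ ^ 2 + ‖g‖ ^ 2))
    (hgBM : ∀ w : Idx → ℂ,
      ‖(Binv (fun i : ↥(cubeIdx 17) => ∑ j ∈ nbrIdx i \ cubeIdx 17,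
          amc i j * w j, 0)).2‖ ^ 2 ≤
        (((1297274033842227 : ℚ) / 1125899906842624 : ℚ) : ℝ) ^ 2 *
          ∑ j ∈ (cubeIdx 17).biUnion nbrIdx \ cubeIdx 17, ‖w j‖ ^ 2)
    (hshellM : ∀ w : Idx → ℂ, (∀ i ∈ cubeIdx 17, w i = 0) →
      (((4464245414306841 : ℚ) / 2251799813685248 : ℚ) : ℝ) * ∑ i ∈ cubeIdx (17 + 1) \ cubeIdx 17, ‖w i‖ ^ 2 ≤
        ∑ i ∈ cubeIdx (17 + 1) \ cubeIdx 17,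
          ((((Row1002C.lamRe : ℚ) : ℝ) : ℂ).re - (-(onormSq i.1 / 100)) - Real.sqrt 2) * ‖w i‖ ^ 2 -
        RCLike.re (∑ i ∈ (cubeIdx 17).biUnion nbrIdx \ cubeIdx 17,
          conj (∑ j : ↥(cubeIdx 17), amc i j *
            (Binv (fun i : ↥(cubeIdx 17) => ∑ j ∈ nbrIdx i \ cubeIdx 17,
              amc i j * w j, 0)).1 j) * w i)) :
    ∃ lam : ℂ, ‖lam - (((Row1002C.lamRe : ℚ) : ℝ) : ℂ)‖ ≤ ((Row1002C.rho : ℚ) : ℝ) ∧ lam.im = 0 ∧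
      ((Row1002C.lamRe : ℚ) : ℝ) - ((Row1002C.rho : ℚ) : ℝ) ≤ lam.re ∧ 0 < lam.re ∧
      (∃ u : UnitAddTorus (Fin 3) → EuclideanSpace ℂ (Fin 3),
        Torus.LinNSResolventRel (1 / (2 * Real.pi * 100)) (Torus.abcFlow 1 1 1) (2 * Real.pi * lam) u 0 ∧
          u ≠ 0 ∧ IsClassII (mFourierCoeff u)) ∧
      (∀ (z : ℂ) (u : UnitAddTorus (Fin 3) → EuclideanSpace ℂ (Fin 3)),
        Torus.LinNSResolventRel (1 / (2 * Real.pi * 100)) (Torus.abcFlow 1 1 1) (2 * Real.pi * z) u 0 → u ≠ 0 →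
          IsClassII (mFourierCoeff u) → ‖z - lam‖ < ((Row1002C.rIso : ℚ) : ℝ) → z = lam) ∧
      (Torus.fps2006_nonlinear_instability_of_eigenvalue →
        Torus.IsLyapunovUnstableSteadyState (1 / (2 * Real.pi * 100))
          (fun x => (4 * Real.pi ^ 2 * (1 / (2 * Real.pi * 100))) • Torus.abcFlow 1 1 1 x)
          (Torus.abcFlow 1 1 1)) := by
  -- the row's constants
  set lt : ℂ := (((Row1002C.lamRe : ℚ) : ℝ) : ℂ) with hlt
  set α : ℝ := ((Row1002C.alpha0 : ℚ) : ℝ) with hαdef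
  set βB : ℝ := ((Row1002C.betaB : ℚ) : ℝ) with hβBdef
  set βC : ℝ := ((Row1002C.betaC : ℚ) : ℝ) with hβCdef
  set gB : ℝ := (((1297274033842227 : ℚ) / 1125899906842624 : ℚ) : ℝ) with hgBdef
  set nt : ℝ := (((5424754208064971 : ℚ) / 2305843009213693952 : ℚ) : ℝ) with hntdef
  set MU2 : ℝ := (((4464245414306841 : ℚ) / 2251799813685248 : ℚ) : ℝ) with hMU2def
  set r₀ : ℝ := ((Row1002C.rnorm : ℚ) : ℝ) with hr₀def
  set μ : ℝ := MU2 - gB * nt with hμdef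
  set M : ℝ := √((1 + βC ^ 2) / μ ^ 2 + (α + βB * √(1 + βC ^ 2) / μ) ^ 2) with hMdef
  have hlt_re : lt.re = ((Row1002C.lamRe : ℚ) : ℝ) := by rw [hlt, Complex.ofReal_re]
  have hlt_im : lt.im = 0 := by rw [hlt, Complex.ofReal_im]
  have hα0 : 0 ≤ α := by rw [hαdef]; exact_mod_cast (by norm_num [Row1002C.alpha0] : (0 : ℚ) ≤ Row1002C.alpha0)
  have hβB0 : 0 ≤ βB := by rw [hβBdef]; exact_mod_cast (by norm_num [Row1002C.betaB] : (0 : ℚ) ≤ Row1002C.betaB)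
  have hβC0 : 0 ≤ βC := by rw [hβCdef]; exact_mod_cast (by norm_num [Row1002C.betaC] : (0 : ℚ) ≤ Row1002C.betaC)
  have hgB0 : 0 ≤ gB := by rw [hgBdef]; exact_mod_cast (by norm_num : (0 : ℚ) ≤ 1297274033842227 / 1125899906842624)
  have hnt0 : 0 ≤ nt := by rw [hntdef]; exact_mod_cast (by norm_num : (0 : ℚ) ≤ 5424754208064971 / 2305843009213693952)
  have hr₀0 : 0 ≤ r₀ := by rw [hr₀def]; exact_mod_cast (by norm_num [Row1002C.rnorm] : (0 : ℚ) ≤ Row1002C.rnorm)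
  -- the printed `μ_eff` is below the exact `MU2 − gB·nt`, and positive
  have hmuμ : ((Row1002C.mu : ℚ) : ℝ) ≤ μ := by
    rw [hμdef, hMU2def, hgBdef, hntdef]
    exact_mod_cast (by norm_num [Row1002C.mu] :
      Row1002C.mu ≤ (4464245414306841 : ℚ) / 2251799813685248 -
        1297274033842227 / 1125899906842624 * (5424754208064971 / 2305843009213693952))
  have hmu0 : 0 < ((Row1002C.mu : ℚ) : ℝ) := by exact_mod_cast Row1002C.mu_pos
  have hμ : 0 < μ := lt_of_lt_of_le hmu0 hmuμ
  -- `M ≤ B := backSubstConst α₀ μ_eff β_B β_C′ ≤ M0` and the chain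
  have hMB : M ≤ backSubstConst Row1002C.alpha0 Row1002C.mu Row1002C.betaB Row1002C.betaC := by
    rw [hMdef, backSubstConst, hαdef, hβBdef, hβCdef]
    exact backSubst_anti hα0 hβB0 hmu0 hmuμ
  obtain ⟨-, hBρ, hBκ, hBiso⟩ := Row1002C.chain_real
  have hB0 : 0 < backSubstConst Row1002C.alpha0 Row1002C.mu Row1002C.betaB Row1002C.betaC := by
    rw [backSubstConst]
    refine Real.sqrt_pos.mpr (add_pos_of_pos_of_nonneg ?_ (sq_nonneg _))
    have : 0 < ((Row1002C.mu : ℚ) : ℝ) := hmu0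
    positivity
  have hM0 : 0 ≤ M := by rw [hMdef]; exact Real.sqrt_nonneg _
  have hκ1 : ((Row1002C.kappa : ℚ) : ℝ) < 1 := by exact_mod_cast Row1002C.kappa_lt_one
  have hκM : 2 * Real.sqrt 2 * M ^ 2 * r₀ ≤ ((Row1002C.kappa : ℚ) : ℝ) := by
    refine le_trans ?_ hBκ
    have : M ^ 2 ≤ backSubstConst Row1002C.alpha0 Row1002C.mu Row1002C.betaB Row1002C.betaC ^ 2 :=
      pow_le_pow_left₀ hM0 hMB 2
    have h2 : 0 ≤ 2 * Real.sqrt 2 := by positivity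
    exact mul_le_mul_of_nonneg_right (mul_le_mul_of_nonneg_left this h2) hr₀0
  have hκ : 2 * Real.sqrt 2 * M ^ 2 * r₀ < 1 := lt_of_le_of_lt hκM hκ1
  have hρ : 2 * M * r₀ ≤ ((Row1002C.rho : ℚ) : ℝ) := by
    refine le_trans ?_ hBρ
    exact mul_le_mul_of_nonneg_right (mul_le_mul_of_nonneg_left hMB zero_le_two) hr₀0
  have hiso : ((Row1002C.rIso : ℚ) : ℝ) ≤ (1 - 2 * Real.sqrt 2 * M ^ 2 * r₀) / M := by
    have hMpos : 0 < M := by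
      rw [hMdef]
      exact Real.sqrt_pos.mpr (add_pos_of_pos_of_nonneg (div_pos (by positivity) (pow_pos hμ 2)) (sq_nonneg _))
    calc ((Row1002C.rIso : ℚ) : ℝ)
        ≤ (1 - ((Row1002C.kappa : ℚ) : ℝ)) /
            backSubstConst Row1002C.alpha0 Row1002C.mu Row1002C.betaB Row1002C.betaC := hBiso
      _ ≤ (1 - 2 * Real.sqrt 2 * M ^ 2 * r₀) /
            backSubstConst Row1002C.alpha0 Row1002C.mu Row1002C.betaB Row1002C.betaC :=
          div_le_div_of_nonneg_right (by linarith) hB0.le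
      _ ≤ (1 - 2 * Real.sqrt 2 * M ^ 2 * r₀) / M :=
          div_le_div_of_nonneg_left (by linarith) hMpos hMB
  have h2ρ : 2 * (2 * M * r₀) < (1 - 2 * Real.sqrt 2 * M ^ 2 * r₀) / M := by
    have hreal : 2 * ((Row1002C.rho : ℚ) : ℝ) < ((Row1002C.rIso : ℚ) : ℝ) := by
      exact_mod_cast Row1002C.real.2
    linarith
  -- the tail constant: `MU2 ≤ Re λ̃ + (K₀+2)²/R − √2`
  have hs : Real.sqrt 2 < 1.41422 := (Real.sqrt_lt' (by norm_num)).mpr (by norm_num)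
  have htailK : MU2 ≤ lt.re + ((17 : ℝ) + 2) ^ 2 / 100 - Real.sqrt 2 := by
    rw [hlt_re, hMU2def]
    have : (((4464245414306841 : ℚ) / 2251799813685248 : ℚ) : ℝ) + 1.41422 ≤
        ((Row1002C.lamRe : ℚ) : ℝ) + ((17 : ℝ) + 2) ^ 2 / 100 := by
      have h := (by norm_num [Row1002C.lamRe] :
        (4464245414306841 : ℚ) / 2251799813685248 + 141422 / 100000 ≤ Row1002C.lamRe + (17 + 2) ^ 2 / 100)
      have h' : (((4464245414306841 : ℚ) / 2251799813685248 + 141422 / 100000 : ℚ) : ℝ) ≤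
          ((Row1002C.lamRe + (17 + 2) ^ 2 / 100 : ℚ) : ℝ) := by exact_mod_cast h
      push_cast at h'
      linarith
    linarith
  -- the general theorem in its classical-eigenpair form
  obtain ⟨lam, hclose, hpair, huniq, hreal⟩ :=
    classII_eigenpair_of_nested_certificate wf hws hwt hwII hwon amc hamc (R := 100) (by norm_num) 17 60 lt
      vt hvt0 hr₀0 hnt0 hres hntb Binv hBinv hα0 hβB0 hβC0 hgB0 hαM hβBM hβCM hgBM hshellM htailK hμdef hμ
      hMdef hκ
  have hclose' : ‖lam - lt‖ ≤ ((Row1002C.rho : ℚ) : ℝ) := hclose.trans hρ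
  have him : lam.im = 0 := hreal hlt_im h2ρ
  have hre : 0 < lam.re := by
    have h1 : |(lam - lt).re| ≤ ‖lam - lt‖ := Complex.abs_re_le_norm _
    rw [Complex.sub_re, hlt_re] at h1
    have h2 : 0 < ((Row1002C.lamRe : ℚ) : ℝ) - ((Row1002C.rho : ℚ) : ℝ) := by
      exact_mod_cast Row1002C.unstable
    have h3 := (abs_le.mp (h1.trans hclose')).1
    linarith
  have hrelo : ((Row1002C.lamRe : ℚ) : ℝ) - ((Row1002C.rho : ℚ) : ℝ) ≤ lam.re := by
    have h1 : |(lam - lt).re| ≤ ‖lam - lt‖ := Complex.abs_re_le_norm _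
    rw [Complex.sub_re, hlt_re] at h1
    have h3 := (abs_le.mp (h1.trans hclose')).1
    linarith
  have heig : Torus.IsLinNSEigenvalue (1 / (2 * Real.pi * 100)) (Torus.abcFlow 1 1 1) (2 * Real.pi * lam) := by
    obtain ⟨u, hu, hu0, -⟩ := hpair
    exact ⟨u, hu0, hu⟩
  refine ⟨lam, hclose', him, hrelo, hre, hpair, fun z u hu hu0 hII hz => huniq z u hu hu0 hII (lt_of_lt_of_le hz hiso),
    fun hFPS => ?_⟩
  have hν : 0 < 1 / (2 * Real.pi * (100 : ℝ)) := by positivity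
  have hμre : 0 < (2 * Real.pi * lam : ℂ).re := by
    have e1 : (2 * Real.pi * lam : ℂ).re = 2 * Real.pi * lam.re := by
      simp [Complex.mul_re, him]
    rw [e1]; positivity
  exact AbcLyapunovInstability.isLyapunovUnstable_abcFlow_of_eigenvalue hFPS hν 1 1 1 hμre heig

end Row

end Summit.NavierStokesRegularity.FluidComputer.AbcClassIIEigenpair

end
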